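import Summits.Ventures.HSemireg.Pad4TowerFCCoreSeam
import Summits.Ventures.HSemireg.Pad4TowerDiamondMu4
import Summits.Ventures.HSemireg.Pad4TowerLineLetters

/-!
# `μ = 32i` IS ATTAINED: the kernel lattice constant `32` of the HALF-SUM LATTICE LAW is SHARP (control g6, 2026-08-29)

Nothing here proves HC, HC_AV, HC_CM, H2 or 18881; census-neutral (a lattice witness, not a census object); no fact, no
instance, no notation.  SORRY-FREE.

`HalfSumLattice.parityAxialDesign_mu_dvd` / `diamondDesign_mu_mem32` give `μ ∈ 32ℤ[i]` (so `|μ|² ≥ 1024` unless `μ = 0`,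
`parityAxialDesign_norm_mu_ge`) for every integer (A1)-clean design with parity-axial letters.  Here, for EVERY even height
`h ≥ 2`, an explicit two-level LINE design `W h` with multiplicities `1` attains `μ = 32i`:
the «two-orbit» design of idea-crit-hsem-2 g3 (memo-21, word W-2ORB of director-hodge R19.29x):
  lower level = the 16 cells `(a, a, a, ρ̄a)` up to the position of `ρ̄a` and a diagonal phase rotation,
  upper level = the 16 cells `(a, a, a, ρa)` likewise,  `a = (h − 1, conj(i^k))` the charge-1 LINE letter, `ρ = ·i`.
All 32 cells lie in `◇_h` and on the line `α + c = h`; the class function is `N(w) = E_h(w) · D(w)` with an `h`-free unit part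
`D` (the e-free letter values `1, h − 1, (h − 1)² − 1` are the same for all 32 cells), and `D` is checked by the kernel
(`decide +kernel`, the `PhaseTorusLawN14` pattern): `D = 0` on every e-mixed word `≠ eeee, ēēēē` and on every e-free word, `D(eeee) = 32i`.
Hence `ClassScreen` holds and `μ = N(eeee) = 32i`, `|μ|² = 1024`: the bound of `parityAxialDesign_norm_mu_ge` is attained at every even height.
-/

namespace Summit.HodgeConjecture.HodgeConjecture.Cruxes.BlochSeedDiscOne.SharpWitness

open Finset BigOperators Summit.Ventures.HSemireg Summit.Ventures.HSemireg.Pad4Tower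

/-! ## §1 the design -/

/-- `Re conj(i^m)`. -/
def ure (m : Fin 4) : ℤ := ![1, 0, -1, 0] m
/-- `Im conj(i^m)`. -/
def uim (m : Fin 4) : ℤ := ![0, -1, 0, 1] m

/-- phase indices of the lower cell `(j, k)`: `k` on every factor, `k + 3` (`= ρ̄`) on factor `j`. -/
def loIdx (p : Fin 4 × Fin 4) (f : Fin 4) : Fin 4 := p.2 + (if f = p.1 then 3 else 0)
/-- phase indices of the upper cell `(j, k)`: `k` on every factor, `k + 1` (`= ρ`) on factor `j`. -/
def upIdx (p : Fin 4 × Fin 4) (f : Fin 4) : Fin 4 := p.2 + (if f = p.1 then 1 else 0)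

/-- the cell with charge-1 LINE letters `(h − 1, conj(i^{m_f}))`. -/
def unitCell (h : ℤ) (m : Fin 4 → Fin 4) : MCell := fun f => (h - 1, ure (m f), uim (m f))

/-- lower cells. -/
def loCell (h : ℤ) (p : Fin 4 × Fin 4) : MCell := unitCell h (loIdx p)
/-- upper cells. -/
def upCell (h : ℤ) (p : Fin 4 × Fin 4) : MCell := unitCell h (upIdx p)

/-- **the witness design** `W h` (16 + 16 cells, multiplicities `1`). -/
def W (h : ℤ) : MConfig := ⟨Finset.univ.image (loCell h), Finset.univ.image (upCell h)⟩

/-- multiplicity `1` everywhere. -/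
def one : MCell → ℤ := fun _ => 1

/-! ## §2 the `h`-free unit part of the class function, checked by the kernel -/

/-- unit part of the letter vector: `(1, 1, 1, β, β̄, 1)`, `β = conj(i^m)`. -/
def Uvec (m : Fin 4) : Fin 6 → GaussianInt := ![1, 1, 1, ⟨ure m, uim m⟩, ⟨ure m, -uim m⟩, 1]
/-- magnitude part of the letter vector: `(1, h − 1, h − 1, 1, 1, (h − 1)² − 1)`. -/
def Evec (h : ℤ) : Fin 6 → GaussianInt :=
  ![1, ((h - 1 : ℤ) : GaussianInt), ((h - 1 : ℤ) : GaussianInt), 1, 1, (((h - 1) ^ 2 - 1 : ℤ) : GaussianInt)]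

/-- unit part of a cell's class tensor. -/
def DU (m : Fin 4 → Fin 4) (w : CWord) : GaussianInt :=
  Uvec (m 0) (w 0) * Uvec (m 1) (w 1) * Uvec (m 2) (w 2) * Uvec (m 3) (w 3)
/-- magnitude part of a cell's class tensor (the same for all 32 cells). -/
def EW (h : ℤ) (w : CWord) : GaussianInt := Evec h (w 0) * Evec h (w 1) * Evec h (w 2) * Evec h (w 3)
/-- the `h`-free unit class function of the design. -/
def D (w : CWord) : GaussianInt := ∑ p : Fin 4 × Fin 4, DU (loIdx p) w - ∑ p : Fin 4 × Fin 4, DU (upIdx p) w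

set_option maxRecDepth 4000 in
/-- (A1)(i) for the unit part: every e-mixed word other than `eeee`, `ēēēē` vanishes (1 294 words, kernel). -/
theorem D_mixed : ∀ w : CWord, ¬ EFree w → w ≠ eWord → w ≠ ebarWord → D w = 0 := by decide +kernel

set_option maxRecDepth 4000 in
/-- the unit part vanishes on e-free words (16 − 16 cells). -/
theorem D_efree : ∀ w : CWord, EFree w → D w = 0 := by decide +kernel

set_option maxRecDepth 4000 in
/-- `D(eeee) = 32i`. -/
theorem D_eWord : D eWord = ⟨0, 32⟩ := by decide +kernel

/-- the phase tables are injective (so the image finsets have 16 cells each and sums over them are sums over `Fin 4 × Fin 4`). -/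
theorem loIdx_inj : ∀ p q : Fin 4 × Fin 4, (∀ f, (ure (loIdx p f), uim (loIdx p f)) = (ure (loIdx q f), uim (loIdx q f))) → p = q := by
  decide
theorem upIdx_inj : ∀ p q : Fin 4 × Fin 4, (∀ f, (ure (upIdx p f), uim (upIdx p f)) = (ure (upIdx q f), uim (upIdx q f))) → p = q := by
  decide

/-! ## §3 factorisation of the class tensor of a charge-1 unit cell -/

theorem unit_sq (m : Fin 4) : ure m ^ 2 + uim m ^ 2 = 1 := by fin_cases m <;> decide

/-- letter by letter: `bphi (h − 1, conj(i^m)) = Evec h · Uvec m`. -/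
theorem bphi_unit (h : ℤ) (m : Fin 4) (l : Fin 6) : bphi (h - 1, ure m, uim m) l = Evec h l * Uvec m l := by
  have hs := unit_sq m
  fin_cases l
  · simp [bphi, phiVec, Evec, Uvec]
  · simp [bphi, phiVec, Evec, Uvec]
  · simp [bphi, phiVec, Evec, Uvec]
  · simp [bphi, phiVec, Evec, Uvec]
  · simp [bphi, phiVec, Evec, Uvec]
  · simp only [bphi, phiVec, Evec, Uvec]
    simp only [Fin.reduceFinMk, Matrix.cons_val, mul_one]
    congr 1
    linear_combination -hs

/-- cell level: `ch(unitCell h m)(w) = EW h w · DU m w`. -/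
theorem ch_unitCell (h : ℤ) (m : Fin 4 → Fin 4) (w : CWord) : (unitCell h m).ch w = EW h w * DU m w := by
  simp only [MCell.ch, chTensor, unitCell, bphi_unit, EW, DU]
  ring

theorem loCell_inj (h : ℤ) : ∀ p ∈ (Finset.univ : Finset (Fin 4 × Fin 4)), ∀ q ∈ (Finset.univ : Finset (Fin 4 × Fin 4)),
    loCell h p = loCell h q → p = q := by
  intro p _ q _ e
  refine loIdx_inj p q fun f => ?_
  have := congrFun e f
  simp only [loCell, unitCell, Prod.mk.injEq] at this
  exact Prod.ext this.2.1 this.2.2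

theorem upCell_inj (h : ℤ) : ∀ p ∈ (Finset.univ : Finset (Fin 4 × Fin 4)), ∀ q ∈ (Finset.univ : Finset (Fin 4 × Fin 4)),
    upCell h p = upCell h q → p = q := by
  intro p _ q _ e
  refine upIdx_inj p q fun f => ?_
  have := congrFun e f
  simp only [upCell, unitCell, Prod.mk.injEq] at this
  exact Prod.ext this.2.1 this.2.2

/-- the class function evaluated at a word (as in `HalfSumLattice.wch_apply`). -/
theorem wch_apply (C : MConfig) (mN mP : MCell → ℤ) (w : CWord) :
    C.wch mN mP w = ∑ Z ∈ C.lower, (mN Z : GaussianInt) * Z.ch w - ∑ P ∈ C.upper, (mP P : GaussianInt) * P.ch w := by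
  simp only [MConfig.wch, Pi.sub_apply, Finset.sum_apply, Pi.smul_apply]
  simp only [zsmul_eq_mul]

/-- **the class function of `W h`** factors: `N(w) = EW h w · D w`. -/
theorem wch_W (h : ℤ) (w : CWord) : (W h).wch one one w = EW h w * D w := by
  rw [wch_apply]
  simp only [W, one, Int.cast_one, one_mul]
  rw [Finset.sum_image (loCell_inj h), Finset.sum_image (upCell_inj h)]
  simp only [loCell, upCell, ch_unitCell, D, Finset.mul_sum, mul_sub]

/-! ## §4 the theorem -/

/-- the class screen (A1) holds for `W h`. -/
theorem classScreen_W (h : ℤ) : ClassScreen ((W h).wch one one) := by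
  refine ⟨fun w h1 h2 h3 => ?_, fun w w' hw hw' _ => ?_⟩
  · rw [wch_W, D_mixed w h1 h2 h3, mul_zero]
  · rw [wch_W, wch_W, D_efree w hw, D_efree w' hw', mul_zero, mul_zero]

/-- `μ(W h) = 32i`. -/
theorem mu_W (h : ℤ) : (W h).wch one one eWord = ⟨0, 32⟩ := by
  rw [wch_W, D_eWord]
  have : EW h eWord = 1 := by simp [EW, eWord, Evec]
  rw [this, one_mul]

/-- `|μ(W h)|² = 1024`: the lower bound of `HalfSumLattice.parityAxialDesign_norm_mu_ge` is attained. -/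
theorem norm_mu_W (h : ℤ) : ((W h).wch one one eWord).norm = 1024 := by
  rw [mu_W]; rfl

/-- every letter `(h − 1, conj(i^m))` lies in `◇_h` (`h ≥ 2` even). -/
theorem unit_inDiamond (h : ℤ) (hh : 2 ≤ h) (he : 2 ∣ h) (m : Fin 4) : InDiamond h (h - 1, ure m, uim m) := by
  have hm : |ure m - uim m| = 1 ∧ ((ure m ≠ 0 ∧ uim m = 0) ∨ (ure m = 0 ∧ uim m ≠ 0)) := by fin_cases m <;> decide
  simp only [InDiamond, AxisPt, absCharge, chargeOf]
  obtain ⟨k, hk⟩ := he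
  refine ⟨Or.inr hm.2, ?_, ?_, ?_⟩ <;> rw [hm.1] <;> omega

/-- `W h ⊂ ◇_h`. -/
theorem inDiamond_W (h : ℤ) (hh : 2 ≤ h) (he : 2 ∣ h) : MConfig.InDiamond h (W h) := by
  constructor
  · intro Z hZ f
    obtain ⟨p, -, rfl⟩ := Finset.mem_image.1 hZ
    exact unit_inDiamond h hh he _
  · intro Z hZ f
    obtain ⟨p, -, rfl⟩ := Finset.mem_image.1 hZ
    exact unit_inDiamond h hh he _

/-- every cell of `W h` is a LINE cell (`α + c = h`, charge `1`). -/
theorem lineCell_W (h : ℤ) : ∀ Z ∈ (W h).lower ∪ (W h).upper, LinePhaseTorus.LineCell h Z := by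
  intro Z hZ
  rcases Finset.mem_union.1 hZ with hZ | hZ
  · obtain ⟨p, -, rfl⟩ := Finset.mem_image.1 hZ
    exact fun f => ⟨1, loIdx p f, by simp [loCell, unitCell, LinePhaseTorus.lineLetter, ure, uim]⟩
  · obtain ⟨p, -, rfl⟩ := Finset.mem_image.1 hZ
    exact fun f => ⟨1, upIdx p f, by simp [upCell, unitCell, LinePhaseTorus.lineLetter, ure, uim]⟩

/-- **SHARPNESS OF `32`.**  For every even `h ≥ 2` there is an integer (A1)-clean two-level LINE design in `◇_h` with non-negative
multiplicities and `μ = 32i`, `|μ|² = 1024` — the kernel bound `μ ∈ 32ℤ[i]`, `|μ|² ≥ 1024` (`HalfSumLattice`: `diamondDesign_mu_mem32`,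
`parityAxialDesign_norm_mu_ge`, via `parityAxial_of_inDiamond`) is attained at every even height. -/
theorem mu32_attained (h : ℤ) (hh : 2 ≤ h) (he : 2 ∣ h) :
    ∃ (C : MConfig) (mN mP : MCell → ℤ), MConfig.InDiamond h C ∧ (∀ Z ∈ C.lower ∪ C.upper, LinePhaseTorus.LineCell h Z) ∧
      (∀ Z, 0 ≤ mN Z) ∧ (∀ Z, 0 ≤ mP Z) ∧ ClassScreen (C.wch mN mP) ∧
      C.wch mN mP eWord = ⟨0, 32⟩ ∧ (C.wch mN mP eWord).norm = 1024 :=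
  ⟨W h, one, one, inDiamond_W h hh he, lineCell_W h, fun _ => by show (0:ℤ) ≤ 1; decide, fun _ => by show (0:ℤ) ≤ 1; decide, classScreen_W h, mu_W h, norm_mu_W h⟩

end Summit.HodgeConjecture.HodgeConjecture.Cruxes.BlochSeedDiscOne.SharpWitness
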